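import Summits.ValiantsHypothesis.ValiantsHypothesis.Theses.SuccinctLift
import Summits.ValiantsHypothesis.ValiantsHypothesis.Theorems.SuccinctLiftFiniteFields
import Summits.ValiantsHypothesis.ValiantsHypothesis.Theorems.SuccinctLiftLefschetz
import Summits.ValiantsHypothesis.ValiantsHypothesis.Theorems.SuccinctLiftCircuitCodes
import Summits.ValiantsHypothesis.ValiantsHypothesis.Theorems.SuccinctLiftNaturalColumn
import Literature.Computability.MetaComplexity.SmolenskyMajority
import Literature.Computability.MetaComplexity.SmolenskyModq
import Literature.Computability.Complexity.ACRealizeOver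
import Summits.ValiantsHypothesis.ValiantsHypothesis.Theorems.SuccinctLiftCharTwoArith
import Summits.ValiantsHypothesis.ValiantsHypothesis.Theorems.SuccinctLiftCharTwoMajority
import Summits.ValiantsHypothesis.ValiantsHypothesis.Theorems.SuccinctLiftCharTwoBridge

/-!
# Line `char2` for crux `P = PerHardSomePrimeLog3` (stmt 23779) of route `SuccinctLift` — GLUE PROOF

Proves the split's glue item `PerHardSomePrimeLog3Glue` (stmt 26307):
`BoolBridgeF2 (26304) → MajorityPermanentMod2 (26305) → SmolenskyBeatsLog3 (26306) → PerHardSomePrimeLog3`,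
sorry-free, against the route decls BY NAME (rev 18).  Take `p = 2`: compose the purported
`𝔽₂`-circuits for `per_m` with the literal MAJORITY-gadget matrix (`ACRealOver.comp`), extract a Boolean
`accBasis 2` circuit for `majorityFn k` (`ACRealOver.toCircuit`) of acDepth `2Δ₁(m)+3` and size
`≤ (2(m^c+c)+3)^(2Δ₁(m)+2) + m²`, and contradict the tree's PROVED `Smolensky.smolensky_majority`.
Then the kernel consequences of `P` on the route (from landed Theorems).
-/

namespace Summit.ValiantsHypothesis.ValiantsHypothesis.Theorems.SuccinctLiftCharTwo
open Literature.Computability.AlgebraicComplexity Literature.Computability.Complexity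
  Literature.Computability.MetaComplexity Literature.Computability.MetaComplexity.Smolensky
  Summit.ValiantsHypothesis.ValiantsHypothesis.Theses.SuccinctLift

/-- Literal realizations: depth `≤ 1`, at most one gate each. -/
theorem acRealOver_lit {k : ℕ} (l : Bool ⊕ (Fin k × Bool)) :
    ACRealOver (accBasis 2)
      (fun x : Fin k → Bool =>
        Sum.elim (fun b : Bool => b) (fun ip : Fin k × Bool => if ip.2 then x ip.1 else !x ip.1) l) 1 1 := by
  rcases l with b | ⟨i, pol⟩
  · exact (acRealOver_const (acBasis_subset_accBasis 2) b).congr fun x => rfl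
  · cases pol
    · exact ((acRealOver_notInput (not_mem_accBasis 2) i).mono zero_le_one le_rfl).congr
        fun x => rfl
    · exact ((acRealOver_input (accBasis 2) i).mono zero_le_one zero_le_one).congr fun x => rfl

/-- **GLUE (stmt 26307), kernel: T2 → T3 → T4 → `PerHardSomePrimeLog3`.** -/
theorem perHardSomePrimeLog3Glue_proof : PerHardSomePrimeLog3Glue := by
  intro hT2 hT3 hT4
  rintro ⟨c, hc⟩
  obtain ⟨k, hk, ℓ, hℓ, hkℓ⟩ := hT4 c
  obtain ⟨m, hm, E, hE⟩ := hT3 k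
  obtain ⟨C, hC, hd, hs⟩ := hc m 2 Nat.prime_two
  obtain ⟨hℓk, hsize⟩ := hkℓ m hm
  set e : Fin (m * m) ≃ Fin m × Fin m := finProdFinEquiv.symm with he
  have hF := hT2 (m * m) (Fin m × Fin m) e C (Nat.log 2 (Nat.log 2 (Nat.log 2 m)) + 1) (m ^ c + c) hd hs
  have hcomp := hF.comp
    (f := fun j x => Sum.elim (fun b : Bool => b)
      (fun ip : Fin k × Bool => if ip.2 then x ip.1 else !x ip.1) (E (e j)))
    fun j => acRealOver_lit (E (e j))
  have hmajR : ACRealOver (accBasis 2) (majorityFn k)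
      (2 * (Nat.log 2 (Nat.log 2 (Nat.log 2 m)) + 1) + 2 + 1)
      ((2 * (m ^ c + c) + 3) ^ (2 * (Nat.log 2 (Nat.log 2 (Nat.log 2 m)) + 1) + 2) + m * m) := by
    refine (hcomp.congr fun x => ?_).mono le_rfl (by simp)
    simp only [Equiv.apply_symm_apply]
    have hev : MvPolynomial.eval (fun i : Fin m × Fin m =>
        if Sum.elim (fun b : Bool => b) (fun ip : Fin k × Bool => if ip.2 then x ip.1 else !x ip.1) (E i)
        then (1 : ZMod 2) else 0) C.eval = if majorityFn k x then 1 else 0 := by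
      rw [hC, eval_perPoly]
      exact hE x
    rw [hev]
    by_cases hmaj : majorityFn k x <;> simp [hmaj]
  obtain ⟨D, hDover, hDdepth, hDsize, hDcomp⟩ := hmajR.toCircuit
  have key := smolensky_majority (p := 2) hk D hDover hDdepth hDcomp hℓ hℓk
  exact absurd (key.trans (Nat.mul_le_mul_left 8 hDsize)) (not_le.2 hsize)

/-- The crux from its children (modus ponens on the glue). -/
theorem perHardSomePrimeLog3_of (hT2 : BoolBridgeF2) (hT3 : MajorityPermanentMod2)
    (hT4 : SmolenskyBeatsLog3) : PerHardSomePrimeLog3 :=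
  perHardSomePrimeLog3Glue_proof hT2 hT3 hT4

/-! ### What the crux discharges on the route (kernel, from landed Theorems) -/

/-- `P ⟹ TOP` (stmt 23654). -/
theorem perHardLog3CF_of_P (h : PerHardSomePrimeLog3) : PerHardLog3CF :=
  Theorems.SuccinctLift.not_perEasyCF_of_not_perEasyEveryPrime
    (fun n => Nat.log 2 (Nat.log 2 (Nat.log 2 n)) + 1) h

/-- `P ⟹ U` (crux r3, stmt 23652). -/
theorem uniformityLiftLog3_of_P (h : PerHardSomePrimeLog3) : UniformityLiftLog3 :=
  fun _ => perHardLog3CF_of_P h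

/-- `P ⟹ A` (crux r2, stmt 23651). -/
theorem succinctPerHardLog3_of_P (h : PerHardSomePrimeLog3) : SuccinctPerHardLog3 :=
  fun hS => perHardLog3CF_of_P h
    (Theorems.SuccinctLift.perEasyCF_of_succinct (β := fun n c => n + c) hS)

/-- `P ⟹ H` (split child, stmt 23720). -/
theorem heightLiftLog3_of_P (h : PerHardSomePrimeLog3) : HeightLiftLog3 :=
  Theorems.SuccinctLift.heightLiftLog3_literal_of_perHardSomePrime h

/-- `P ⟹ PinnedUniformityLiftLog3` (aside, stmt 23558): its conclusion is `TOP`. -/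
theorem pinnedUniformityLiftLog3_of_P (h : PerHardSomePrimeLog3) : PinnedUniformityLiftLog3 :=
  fun _ => perHardLog3CF_of_P h

/-- `P ⟹ DCharLog3` (aside, stmt 23864): its conclusion is `P`. -/
theorem dCharLog3_of_P (h : PerHardSomePrimeLog3) : DCharLog3 :=
  fun _ => h

/-- Given `P`, `AlgDescentLog3` (stmt 23721) ⟺ lens 4's `PerHardLog3`. -/
theorem algDescentLog3_iff_perHardLog3_of_P (h : PerHardSomePrimeLog3) :
    AlgDescentLog3 ↔ PerHardLog3 := by
  have hI := Theorems.SuccinctLift.not_perEasyIntAdv_of_not_perEasyEveryPrime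
    (fun n => Nat.log 2 (Nat.log 2 (Nat.log 2 n)) + 1) h
  have hAC : (¬ Theorems.SuccinctLift.PerEasyAlg fun n => Nat.log 2 (Nat.log 2 (Nat.log 2 n)) + 1) ↔
      ¬ Theorems.SuccinctLift.PerEasyComplex fun n => Nat.log 2 (Nat.log 2 (Nat.log 2 n)) + 1 :=
    (Theorems.SuccinctLift.perHardCofiniteChar_iff_not_perEasyAlg _).symm.trans
      (Theorems.SuccinctLift.perHardCofiniteChar_iff_not_perEasyComplex _)
  exact ⟨fun hD => hAC.1 (hD hI), fun hP _ => hAC.2 hP⟩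

/-- Given `P`, `DLefLog3` (aside, stmt 23865) ⟺ `PerHardLog3`. -/
theorem dLefLog3_iff_perHardLog3_of_P (h : PerHardSomePrimeLog3) : DLefLog3 ↔ PerHardLog3 := by
  have hAC : (¬ Theorems.SuccinctLift.PerEasyAlg fun n => Nat.log 2 (Nat.log 2 (Nat.log 2 n)) + 1) ↔
      ¬ Theorems.SuccinctLift.PerEasyComplex fun n => Nat.log 2 (Nat.log 2 (Nat.log 2 n)) + 1 :=
    (Theorems.SuccinctLift.perHardCofiniteChar_iff_not_perEasyAlg _).symm.trans
      (Theorems.SuccinctLift.perHardCofiniteChar_iff_not_perEasyComplex _)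
  exact ⟨fun hD => hAC.1 (hD h), fun hP _ => hAC.2 hP⟩

/-- Given `P`, `K_alg = AlgConstantLiftLog3` (crux r4, stmt 23684) ⟺ `PerHardLog3`. -/
theorem algConstantLiftLog3_iff_perHardLog3_of_P (h : PerHardSomePrimeLog3) :
    AlgConstantLiftLog3 ↔ PerHardLog3 := by
  have hT := perHardLog3CF_of_P h
  have hAC : (¬ Theorems.SuccinctLift.PerEasyAlg fun n => Nat.log 2 (Nat.log 2 (Nat.log 2 n)) + 1) ↔
      ¬ Theorems.SuccinctLift.PerEasyComplex fun n => Nat.log 2 (Nat.log 2 (Nat.log 2 n)) + 1 :=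
    (Theorems.SuccinctLift.perHardCofiniteChar_iff_not_perEasyAlg _).symm.trans
      (Theorems.SuccinctLift.perHardCofiniteChar_iff_not_perEasyComplex _)
  exact ⟨fun hK => hAC.1 (hK hT), fun hP _ => hAC.2 hP⟩

/-- Given `P`, `K = ConstantLiftLog3` (aside, stmt 23653) ⟺ `PerHardLog3`. -/
theorem constantLiftLog3_iff_perHardLog3_of_P (h : PerHardSomePrimeLog3) :
    ConstantLiftLog3 ↔ PerHardLog3 :=
  ⟨fun hK => hK (perHardLog3CF_of_P h), fun hP _ => hP⟩

/-- **Node collapse.** Given `P`, the binders of `closes` (`A ∧ U ∧ K_alg ∧ B`) are equivalent to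
lens 4's node `PerHardLog3 ∧ CollapseLog3`. -/
theorem closes_hypotheses_iff_depthWindow_of_P (h : PerHardSomePrimeLog3) :
    (SuccinctPerHardLog3 ∧ UniformityLiftLog3 ∧ AlgConstantLiftLog3 ∧ CollapseLog3) ↔
      (PerHardLog3 ∧ CollapseLog3) := by
  constructor
  · rintro ⟨-, -, hK, hB⟩
    exact ⟨(algConstantLiftLog3_iff_perHardLog3_of_P h).1 hK, hB⟩
  · rintro ⟨hP, hB⟩
    exact ⟨succinctPerHardLog3_of_P h, uniformityLiftLog3_of_P h,
      (algConstantLiftLog3_iff_perHardLog3_of_P h).2 hP, hB⟩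

/-- Hence, given `P`, `VH` follows from lens 4's two items alone (via the route's `closes`). -/
theorem vh_of_perHardLog3_of_collapse_of_P (h : PerHardSomePrimeLog3) (hP : PerHardLog3)
    (hB : CollapseLog3) : _root_.ValiantsHypothesis :=
  closes (succinctPerHardLog3_of_P h) (uniformityLiftLog3_of_P h)
    ((algConstantLiftLog3_iff_perHardLog3_of_P h).2 hP) hB

end Summit.ValiantsHypothesis.ValiantsHypothesis.Theorems.SuccinctLiftCharTwo


/-! ## Closing `P` and its corollaries (unconditional) -/

namespace Summit.ValiantsHypothesis.ValiantsHypothesis.Theorems.SuccinctLiftCharTwo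
open Summit.ValiantsHypothesis.ValiantsHypothesis.Theses.SuccinctLift
/-- **P = stmt-ValiantsHypothesis-23779.** The permanent over `𝔽₂ = ZMod 2` has no polynomial-size
arithmetic circuits of product-depth `log₂log₂log₂ n + 1`; hence not at every prime. -/
theorem perHardSomePrimeLog3_proof : PerHardSomePrimeLog3 :=
  perHardSomePrimeLog3_of boolBridgeF2_proof majorityPermanentMod2_proof smolenskyBeatsLog3_proof

/-- A = stmt-ValiantsHypothesis-23651. -/
theorem succinctPerHardLog3_proof : SuccinctPerHardLog3 := succinctPerHardLog3_of_P perHardSomePrimeLog3_proof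

/-- U = stmt-ValiantsHypothesis-23652. -/
theorem uniformityLiftLog3_proof : UniformityLiftLog3 := uniformityLiftLog3_of_P perHardSomePrimeLog3_proof

/-- TOP = stmt-ValiantsHypothesis-23654 (`PerHardLog3CF`, constant-free log³ permanent hardness). -/
theorem perHardLog3CF_proof : PerHardLog3CF := perHardLog3CF_of_P perHardSomePrimeLog3_proof

/-- stmt-ValiantsHypothesis-23720. -/
theorem heightLiftLog3_proof : HeightLiftLog3 := heightLiftLog3_of_P perHardSomePrimeLog3_proof

/-- stmt-ValiantsHypothesis-23558. -/
theorem pinnedUniformityLiftLog3_proof : PinnedUniformityLiftLog3 :=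
  pinnedUniformityLiftLog3_of_P perHardSomePrimeLog3_proof

/-- stmt-ValiantsHypothesis-23864. -/
theorem dCharLog3_proof : DCharLog3 := dCharLog3_of_P perHardSomePrimeLog3_proof

/-- What is left of `closes`: `AlgConstantLiftLog3 ↔ PerHardLog3` (lens-4 node). -/
theorem algConstantLiftLog3_iff_perHardLog3 : AlgConstantLiftLog3 ↔ PerHardLog3 :=
  algConstantLiftLog3_iff_perHardLog3_of_P perHardSomePrimeLog3_proof

/-- Helper `algDescentLog3_iff_perHardLog3` of the char-2 line (see the module docstring). -/
theorem algDescentLog3_iff_perHardLog3 : AlgDescentLog3 ↔ PerHardLog3 :=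
  algDescentLog3_iff_perHardLog3_of_P perHardSomePrimeLog3_proof

/-- Helper `constantLiftLog3_iff_perHardLog3` of the char-2 line (see the module docstring). -/
theorem constantLiftLog3_iff_perHardLog3 : ConstantLiftLog3 ↔ PerHardLog3 :=
  constantLiftLog3_iff_perHardLog3_of_P perHardSomePrimeLog3_proof

/-- Helper `dLefLog3_iff_perHardLog3` of the char-2 line (see the module docstring). -/
theorem dLefLog3_iff_perHardLog3 : DLefLog3 ↔ PerHardLog3 :=
  dLefLog3_iff_perHardLog3_of_P perHardSomePrimeLog3_proof

/-- The four hypotheses of `SuccinctLift.closes` are now exactly the lens-4 `DepthWindow` node. -/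
theorem closes_hypotheses_iff_depthWindow :
    (SuccinctPerHardLog3 ∧ UniformityLiftLog3 ∧ AlgConstantLiftLog3 ∧ CollapseLog3) ↔
      (PerHardLog3 ∧ CollapseLog3) :=
  closes_hypotheses_iff_depthWindow_of_P perHardSomePrimeLog3_proof

/-- `VH` from the lens-4 node alone. -/
theorem vh_of_perHardLog3_of_collapse (h : PerHardLog3) (hB : CollapseLog3) :
    _root_.ValiantsHypothesis :=
  vh_of_perHardLog3_of_collapse_of_P perHardSomePrimeLog3_proof h hB

/-- W_eng = stmt-ValiantsHypothesis-25046 (`EngineLiftLog3 := R_eng → A`), trivially from A. -/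
theorem engineLiftLog3_proof : EngineLiftLog3 := fun _ => succinctPerHardLog3_proof


/-! ### The remaining asides of the column (unconditional): floor, engine rung, A′, and the collapse aside -/

/-- floor (aside, stmt 23476): for every `k`, no `(log₂ n)^k + c`-succinct constant-free depth-Δ₁ poly-wire
circuits for per — from `PerHardLog3CF` (succinctness is not even needed). -/
theorem succinctRungPolylogLog3_proof : SuccinctRungPolylogLog3 :=
  fun k hS => perHardLog3CF_proof
    (Theorems.SuccinctLift.perEasyCF_of_succinct (β := fun n c => Nat.log 2 n ^ k + c) hS)

/-- Budget bookkeeping: `n ^ a + c ≤ n ^ (a + c + 1) + (a + c + 1)`. -/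
theorem pow_add_le_pow_succ (n a c : ℕ) : n ^ a + c ≤ n ^ (a + c + 1) + (a + c + 1) := by
  rcases Nat.eq_zero_or_pos n with rfl | hn
  · rcases Nat.eq_zero_or_pos a with rfl | ha
    · simp only [pow_zero, Nat.zero_add]; omega
    · rw [zero_pow ha.ne', zero_pow (by omega)]; omega
  · have := Nat.pow_le_pow_right hn (show a ≤ a + c + 1 by omega); omega

/-- R_eng (aside, stmt 25045), at level `e = 0`: from `PerHardLog3CF` (the description budget is not needed). -/
theorem succinctRungEngineLog3_proof : SuccinctRungEngineLog3 := by
  refine ⟨0, fun a h => perHardLog3CF_proof ?_⟩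
  obtain ⟨c, hc⟩ := h
  refine ⟨a + c + 1, fun n => ?_⟩
  obtain ⟨C, C', h1, h2, h3, h4, h5, -⟩ := hc n
  exact ⟨C, C', h1, h2, h3, h4, h5.trans (pow_add_le_pow_succ n a c)⟩

/-- Transport of the pinned tail along an equality of address widths. -/
theorem pinTail_congr (L : List Bool) (s : ℕ) {w w' : ℕ} (h : w = w') :
    (L.length ≤ 2 ^ w ∧ ∃ D : Literature.Computability.Complexity.Circuit (Fin w),
        D.IsOver Literature.Computability.Complexity.B2 ∧ D.size ≤ s ∧
          D.Computes fun a => L.getD (∑ t : Fin w, if a t then 2 ^ (t : ℕ) else 0) false) ↔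
    (L.length ≤ 2 ^ w' ∧ ∃ D : Literature.Computability.Complexity.Circuit (Fin w'),
        D.IsOver Literature.Computability.Complexity.B2 ∧ D.size ≤ s ∧
          D.Computes fun a => L.getD (∑ t : Fin w', if a t then 2 ^ (t : ℕ) else 0) false) := by
  subst h; exact Iff.rfl

/-- Dictionary: the item `PinnedPerHardLog3` is pinned hardness at budget `n + c`, canonical width, depth Δ₁
(definitional up to `1 + k = k + 1`). -/
theorem pinnedPerHardLog3_iff_pinnedClass :
    PinnedPerHardLog3 ↔
      ¬ ∃ c : ℕ, ∀ n : ℕ, Literature.Computability.AlgebraicComplexity.perPoly (Fin n) ℂ ∈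
        Theorems.SuccinctLift.PinnedClass (fun n => Nat.log 2 (Nat.log 2 (Nat.log 2 n)) + 1) n c
          (Theorems.SuccinctLift.canonWidth n c) (n + c) := by
  unfold PinnedPerHardLog3
  refine Iff.not (exists_congr fun c => forall_congr' fun n => ?_)
  simp only [Theorems.SuccinctLift.PinnedClass, Set.mem_setOf_eq, Theorems.SuccinctLift.canonWidth,
    Theorems.SuccinctLift.codeLen]
  exact exists_congr fun C => exists_congr fun C' => and_congr_right fun _ => and_congr_right fun _ =>
    and_congr_right fun _ => and_congr_right fun _ => and_congr_right fun _ =>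
      pinTail_congr _ _ (Nat.add_comm _ _)

/-- **A′ (aside, stmt 23557), proved**: from A by `perHardPinned_of_perHardSuccinct` through the dictionary. -/
theorem pinnedPerHardLog3_proof : PinnedPerHardLog3 :=
  pinnedPerHardLog3_iff_pinnedClass.mpr
    (Theorems.SuccinctLift.perHardPinned_of_perHardSuccinct (β := fun n c => n + c)
      (Δ := fun n => Nat.log 2 (Nat.log 2 (Nat.log 2 n)) + 1) succinctPerHardLog3_proof)

/-- The aside `SuccinctCollapseLog3` (stmt 23657) is now LITERALLY the summit: `(VP = VNP → succinct easiness)`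
with succinct easiness refuted is `VP ≠ VNP`. -/
theorem succinctCollapseLog3_iff_vh : SuccinctCollapseLog3 ↔ _root_.ValiantsHypothesis := by
  constructor
  · intro h
    show Literature.Computability.AlgebraicComplexity.VP ℂ ≠ Literature.Computability.AlgebraicComplexity.VNP ℂ
    exact fun heq => succinctPerHardLog3_proof (h heq)
  · intro hv heq
    exact absurd heq hv

end Summit.ValiantsHypothesis.ValiantsHypothesis.Theorems.SuccinctLiftCharTwo
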